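import Mathlib
import Summits.NavierStokesRegularity.NavierStokesRegularity.Theorems.ScenarioCensusPeriodicSlabLiouville
import Summits.NavierStokesRegularity.NavierStokesRegularity.Theorems.ScenarioCensusHelicalSlabTools
import HarnessLib

/-!
# Census row S6 (bounded helical steady flows): the pressure of a bounded axially periodic
# steady flow is axially periodic

Support file for the scenario census of `NavierStokesRegularity` (cell `pub/ns-census`, block S,
row S6 = Han–Wang–Xie, arXiv:2312.10382, Thm 1.1; tree FACT
`Literature.Analysis.FluidPDE.HanWangXie2023_helical_liouville`). The printed proof uses
Lemma 2.7 (= Bang–Gui–Wang–Xie 2025, Lemma "periodic pressure"): "Let `u` be a bounded smooth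
solution to the Navier–Stokes system in `ℝ² × 𝕋`. The pressure `P` is also a periodic function
with respect to `z`" — it is what makes the energy identity on one period hold without pressure
boundary terms. Here (`steady_pressure_periodic`, viscosity normalised to `1`):

* the pressure GRADIENT is periodic (`∇P = ΔU − (U·∇)U`), so the period defect
  `P(x + L e₃) − P(x) = c₀` is a constant (`steady_pressure_defect`);
* `c₀ ∫_{slab} φ = L ∫_{slab} φ ∂₃P` for every `z`-independent cut-off `φ` (FTC on vertical lines +
  signed vertical averaging, `…HelicalSlabTools`), and testing the `e₃`-component of the momentum
  equation against `φ ω_L²` (Green's identity and the trilinear identity of `WholeSpaceIBP`, window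
  bookkeeping of `…PeriodicSlabWindow`) gives `|∫_{slab} φ_R ∂₃P| ≤ C R` for the cylindrical
  cut-offs `φ_R = cylCutoff R (2R)`, while `∫_{slab} φ_R ≥ L R²`; letting `R → ∞`, `c₀ = 0`.

No summit statement and no census row is proved in this file.

## References

* J. Han, Y. Wang, C. Xie, arXiv:2312.10382 (2023), Lemma 2.7. [HanWangXie2023]
* J. Bang, C. Gui, Y. Wang, C. Xie, J. Fluid Mech. 1005 (2025) A6 = arXiv:2205.13259, §2
  (periodicity of the pressure for bounded flows in `ℝ² × 𝕋`). [BangGuiWangXie2025]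
-/

-- the summit and its single problem share the name (D-0017 nested layout)
set_option linter.dupNamespace false

noncomputable section

open MeasureTheory Set Function Filter InnerProductSpace
open scoped Topology ENNReal NNReal RealInnerProductSpace Laplacian ContDiff

namespace Summit.NavierStokesRegularity.NavierStokesRegularity.Theorems.ScenarioCensus.HelicalSlab

open Literature.Analysis Literature.Analysis.FluidPDE
open Summit.NavierStokesRegularity.NavierStokesRegularity.Theorems.ScenarioCensus.PeriodicSlab

/-! ### The period defect of the pressure is a constant -/

/-- For a steady classical flow with axially `L`-periodic velocity, the pressure has a CONSTANT
period defect: `P(x + L e₃) − P(x) = P(L e₃) − P(0)` for all `x` (its gradient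
`∇P = νΔU − (U·∇)U` is periodic). -/
theorem steady_pressure_defect {ν L : ℝ}
    {U : EuclideanSpace ℝ (Fin 3) → EuclideanSpace ℝ (Fin 3)} {P : EuclideanSpace ℝ (Fin 3) → ℝ}
    (h : IsSteadyClassicalNS ν 0 U P) (hper : IsAxiallyPeriodic L U) (x : EuclideanSpace ℝ (Fin 3)) :
    P (x + L • eZ) - P x = P (L • eZ) - P 0 := by
  set b := stdOrthonormalBasis ℝ (EuclideanSpace ℝ (Fin 3)) with hb
  have hPd : Differentiable ℝ P := h.smooth_pressure.differentiable (by simp)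
  have hgrad : ∀ y, gradient P y = ν • (Δ U) y - convect U U y := fun y => by
    have hm := h.momentum y
    rw [Pi.zero_apply, add_zero] at hm
    rw [hm]; abel
  have hΔper : IsAxiallyPeriodic L (Δ U) := fun y => by
    rw [InnerProductSpace.laplacian_eq_iteratedFDeriv_orthonormalBasis U b]
    simp only [isAxiallyPeriodic_iteratedFDeriv hper 2 y]
  have hconvper : ∀ y, convect U U (y + L • EuclideanSpace.single 2 (1 : ℝ)) = convect U U y :=
    fun y => by simp only [convect_apply, isAxiallyPeriodic_fderiv hper y, hper y]
  have hgradper : ∀ y, gradient P (y + L • eZ) = gradient P y := fun y => by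
    rw [hgrad, hgrad]
    show ν • (Δ U) (y + L • EuclideanSpace.single 2 (1 : ℝ)) -
        convect U U (y + L • EuclideanSpace.single 2 (1 : ℝ)) = _
    rw [hΔper y, hconvper y]
  -- the defect has zero derivative
  set π : EuclideanSpace ℝ (Fin 3) → ℝ := fun y => P (y + L • eZ) - P y with hπ
  have hπd : Differentiable ℝ π := (hPd.comp (differentiable_id.add_const _)).sub hPd
  have hDπ : ∀ y, fderiv ℝ π y = 0 := fun y => by
    have h1 : fderiv ℝ (fun z => P (z + L • eZ)) y = fderiv ℝ P (y + L • eZ) :=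
      fderiv_comp_add_right (L • eZ)
    have hf : DifferentiableAt ℝ (fun z => P (z + L • eZ)) y :=
      (hPd _).comp y (differentiableAt_id.add_const _)
    show fderiv ℝ (fun z => P (z + L • eZ) - P z) y = 0
    rw [fderiv_fun_sub hf (hPd y), h1]
    have e : ∀ z, fderiv ℝ P z = (InnerProductSpace.toDual ℝ _ ) (gradient P z) := fun z => by
      rw [gradient, LinearIsometryEquiv.apply_symm_apply]
    rw [e, e, hgradper, sub_self]
  have := is_const_of_fderiv_eq_zero hπd hDπ x 0
  simpa [hπ] using this

/-- The vertical period integral of `∂₃P` is the period defect of `P` (FTC). -/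
theorem verticalIntegral_fderiv_eZ {L : ℝ} {P : EuclideanSpace ℝ (Fin 3) → ℝ} (hP : ContDiff ℝ 1 P)
    (x : EuclideanSpace ℝ (Fin 3)) :
    ∫ s in (0 : ℝ)..L, fderiv ℝ P (x + s • eZ) eZ = P (x + L • eZ) - P x := by
  have hPd : Differentiable ℝ P := hP.differentiable one_ne_zero
  have hc : Continuous fun s : ℝ => fderiv ℝ P (x + s • eZ) eZ :=
    ((hP.continuous_fderiv one_ne_zero).comp (continuous_const.add
      (continuous_id.smul continuous_const))).clm_apply continuous_const
  rw [intervalIntegral.integral_eq_sub_of_hasDerivAt (fun s _ => hasDerivAt_comp_add_smul_eZ hPd x s)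
    (hc.intervalIntegrable _ _), zero_smul, add_zero]

/-! ### The flux identity: the `e₃`-momentum equation tested against `φ ω_L²` -/

/-- **The pressure flux identity per period.** For a steady classical flow `(U, P)` at unit
viscosity with `U` axially `L`-periodic (`L > 0`) and an axially periodic `C¹` cut-off `φ ≥ 0`
vanishing off a cylinder:
`∫_S φ ∂₃P = −Σᵢ ∫_S (∂ᵢφ) ⟪∂ᵢU, e₃⟫ + ∫_S (Dφ·U) ⟪U, e₃⟫` (`S = zSlab L 0`), i.e. the
`e₃`-component of `∇P = ΔU − (U·∇)U` integrated by parts against `φ` over one period (through the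
window `ω_L²`; the window-derivative terms vanish by periodicity). -/
theorem pressure_flux_identity {L : ℝ} (hL : 0 < L)
    {U : EuclideanSpace ℝ (Fin 3) → EuclideanSpace ℝ (Fin 3)} {P : EuclideanSpace ℝ (Fin 3) → ℝ}
    (h : IsSteadyClassicalNS 1 0 U P) (hUper : IsAxiallyPeriodic L U)
    {φ : EuclideanSpace ℝ (Fin 3) → ℝ} (hφ : ContDiff ℝ 1 φ) (hφper : IsAxiallyPeriodic L φ)
    (hφnn : ∀ x, 0 ≤ φ x) {ρ : ℝ} (hφ0 : ∀ x, ρ ≤ cylRadius x → φ x = 0) :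
    ∫ x in zSlab L 0, φ x * fderiv ℝ P x eZ =
      -(∑ i, ∫ x in zSlab L 0, fderiv ℝ φ x (EuclideanSpace.basisFun (Fin 3) ℝ i) *
          ⟪fderiv ℝ U x (EuclideanSpace.basisFun (Fin 3) ℝ i), eZ⟫) +
        ∫ x in zSlab L 0, fderiv ℝ φ x (U x) * ⟪U x, eZ⟫ := by
  set b := EuclideanSpace.basisFun (Fin 3) ℝ with hb
  set ω2 : ℝ → ℝ := fun s => periodicWindow L s ^ 2 with hω2
  set Φ : EuclideanSpace ℝ (Fin 3) → ℝ := fun x => φ x * ω2 (x 2) with hΦ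
  set W : EuclideanSpace ℝ (Fin 3) → EuclideanSpace ℝ (Fin 3) := fun x => Φ x • eZ with hW
  -- regularity
  have hU : ContDiff ℝ ∞ U := h.smooth_velocity
  have hP : ContDiff ℝ ∞ P := h.smooth_pressure
  have hU1 : ContDiff ℝ 1 U := contDiff_infty.1 hU 1
  have hU2 : ContDiff ℝ 2 U := contDiff_infty.1 hU 2
  have hP1 : ContDiff ℝ 1 P := contDiff_infty.1 hP 1
  have hUc : Continuous U := hU1.continuous
  have hDUc : Continuous (fderiv ℝ U) := hU1.continuous_fderiv one_ne_zero
  have hDPc : Continuous (fderiv ℝ P) := hP1.continuous_fderiv one_ne_zero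
  have hφc : Continuous φ := hφ.continuous
  have hDφc : Continuous (fderiv ℝ φ) := hφ.continuous_fderiv one_ne_zero
  have hω2c : ContDiff ℝ 1 ω2 := contDiff_periodicWindow_sq L
  have hΦ1 : ContDiff ℝ 1 Φ := contDiff_mul_comp_apply_two hφ hω2c
  have hΦc : HasCompactSupport Φ :=
    hasCompactSupport_mul_comp_apply_two hφ0 (abs_le_of_periodicWindow_sq_ne_zero hL)
  have hΦcn : Continuous Φ := hΦ1.continuous
  have hDΦc : Continuous (fderiv ℝ Φ) := hΦ1.continuous_fderiv one_ne_zero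
  have hΦd : ∀ x, DifferentiableAt ℝ Φ x := fun x => hΦ1.differentiable one_ne_zero x
  have hW1 : ContDiff ℝ 1 W := hΦ1.smul contDiff_const
  have hWc : HasCompactSupport W := hΦc.smul_right
  have hDW : ∀ x v, fderiv ℝ W x v = fderiv ℝ Φ x v • eZ := fun x v => by
    rw [hW, ((hΦd x).hasFDerivAt.smul_const eZ).fderiv, ContinuousLinearMap.smulRight_apply]
  -- the derivative of the nonnegative cut-off vanishes where the cut-off vanishes
  have hφD0 : ∀ x, ρ ≤ cylRadius x → fderiv ℝ φ x = 0 := fun x hx => by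
    have hmin : IsLocalMin φ x := Eventually.of_forall fun y => by rw [hφ0 x hx]; exact hφnn y
    exact hmin.fderiv_eq_zero
  have hDΦ : ∀ (x v : EuclideanSpace ℝ (Fin 3)),
      fderiv ℝ Φ x v = ω2 (x 2) * fderiv ℝ φ x v + φ x * deriv ω2 (x 2) * v 2 := fun x v =>
    fderiv_mul_comp_apply_two (hφ.differentiable one_ne_zero x) (hω2c.differentiable one_ne_zero _) v
  -- periodicity
  have hDUper : IsAxiallyPeriodic L (fderiv ℝ U) := isAxiallyPeriodic_fderiv hUper
  have hDφper : IsAxiallyPeriodic L (fderiv ℝ φ) := isAxiallyPeriodic_fderiv hφper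
  obtain ⟨hqper, -⟩ := steady_pressure_partial h hUper
  -- the momentum equation, `e₃`-component, tested against `Φ`
  have hq : ∀ y, fderiv ℝ P y eZ = ⟪(Δ U) y, eZ⟫ - ⟪convect U U y, eZ⟫ := fun y => by
    have hm := h.momentum y
    rw [Pi.zero_apply, add_zero, one_smul] at hm
    have hg : gradient P y = (Δ U) y - convect U U y := by rw [hm]; abel
    rw [show fderiv ℝ P y eZ = ⟪gradient P y, eZ⟫ by
      rw [gradient, InnerProductSpace.toDual_symm_apply], hg, inner_sub_left]
  -- (1) Green's identity with the test field `W = Φ e₃`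
  have green := FluidPDE.integral_inner_laplacian_add_eq_zero b hU2 hW1 (Or.inr hWc)
  have hg1 : ∀ x, ⟪(Δ U) x, W x⟫ = Φ x * ⟪(Δ U) x, eZ⟫ := fun x => by
    rw [hW, real_inner_smul_right]
  have hg2 : ∀ x i, ⟪fderiv ℝ U x (b i), fderiv ℝ W x (b i)⟫ =
      fderiv ℝ Φ x (b i) * ⟪fderiv ℝ U x (b i), eZ⟫ := fun x i => by
    rw [hDW, real_inner_smul_right]
  -- (2) the trilinear identity with the test field `W`
  have conv := FluidPDE.integral_inner_convect_add_eq_zero (F' := EuclideanSpace ℝ (Fin 3)) hU1 hU1 hW1 hWc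
  have hc1 : ∀ x, ⟪convect U U x, W x⟫ = Φ x * ⟪convect U U x, eZ⟫ := fun x => by
    rw [hW, real_inner_smul_right]
  have hc2 : ∀ x, ⟪U x, convect U W x⟫ = fderiv ℝ Φ x (U x) * ⟪U x, eZ⟫ := fun x => by
    rw [convect_apply, hDW, real_inner_smul_right]
  have hc3 : ∫ x, VectorCalculus.divergence U x * ⟪U x, W x⟫ = 0 := by
    rw [← integral_zero (α := EuclideanSpace ℝ (Fin 3)) (G := ℝ)]
    refine integral_congr_ae (Eventually.of_forall fun x => ?_)
    show VectorCalculus.divergence U x * ⟪U x, W x⟫ = 0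
    rw [h.divFree x, zero_mul]
  -- integrability (continuous, compactly supported)
  have hcsΦ : ∀ f : EuclideanSpace ℝ (Fin 3) → ℝ, Continuous f →
      Integrable fun x => Φ x * f x := fun f hf =>
    (hΦcn.mul hf).integrable_of_hasCompactSupport hΦc.mul_right
  have hDΦcs : HasCompactSupport (fderiv ℝ Φ) := hΦc.fderiv (𝕜 := ℝ)
  have hcsD : ∀ (v : EuclideanSpace ℝ (Fin 3) → EuclideanSpace ℝ (Fin 3)) (f : EuclideanSpace ℝ (Fin 3) → ℝ),
      Continuous v → Continuous f → Integrable fun x => fderiv ℝ Φ x (v x) * f x := by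
    intro v f hv hf
    refine ((hDΦc.clm_apply hv).mul hf).integrable_of_hasCompactSupport (hDΦcs.mono fun x hx => ?_)
    rw [mem_support] at hx ⊢
    contrapose! hx
    simp [hx]
  have hconvc : Continuous fun x => ⟪convect U U x, eZ⟫ := by
    simp only [convect_apply]; exact (hDUc.clm_apply hUc).inner continuous_const
  have hΔc : Continuous fun x => ⟪(Δ U) x, eZ⟫ := by
    have e : (fun x => ⟪(Δ U) x, eZ⟫) = fun x => fderiv ℝ P x eZ + ⟪convect U U x, eZ⟫ :=
      funext fun x => by rw [hq x]; ring
    rw [e]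
    exact (hDPc.clm_apply continuous_const).add hconvc
  -- rewrite every pairing
  have e1 : ∫ x, ⟪(Δ U) x, W x⟫ = ∫ x, Φ x * ⟪(Δ U) x, eZ⟫ :=
    integral_congr_ae (Eventually.of_forall hg1)
  have e2 : ∑ i, ∫ x, ⟪fderiv ℝ U x (b i), fderiv ℝ W x (b i)⟫ =
      ∑ i, ∫ x, fderiv ℝ Φ x (b i) * ⟪fderiv ℝ U x (b i), eZ⟫ :=
    Finset.sum_congr rfl fun i _ => integral_congr_ae (Eventually.of_forall fun x => hg2 x i)
  have e3 : ∫ x, ⟪convect U U x, W x⟫ = ∫ x, Φ x * ⟪convect U U x, eZ⟫ :=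
    integral_congr_ae (Eventually.of_forall hc1)
  have e4 : ∫ x, ⟪U x, convect U W x⟫ = ∫ x, fderiv ℝ Φ x (U x) * ⟪U x, eZ⟫ :=
    integral_congr_ae (Eventually.of_forall hc2)
  rw [e1, e2] at green
  rw [e3, e4, hc3] at conv
  have e5 : ∫ x, Φ x * fderiv ℝ P x eZ =
      (∫ x, Φ x * ⟪(Δ U) x, eZ⟫) - ∫ x, Φ x * ⟪convect U U x, eZ⟫ := by
    rw [← integral_sub (hcsΦ _ hΔc) (hcsΦ _ hconvc)]
    refine integral_congr_ae (Eventually.of_forall fun x => ?_)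
    show Φ x * fderiv ℝ P x eZ = Φ x * ⟪(Δ U) x, eZ⟫ - Φ x * ⟪convect U U x, eZ⟫
    rw [hq x]; ring
  have whole : ∫ x, Φ x * fderiv ℝ P x eZ =
      -(∑ i, ∫ x, fderiv ℝ Φ x (b i) * ⟪fderiv ℝ U x (b i), eZ⟫) +
        ∫ x, fderiv ℝ Φ x (U x) * ⟪U x, eZ⟫ := by
    rw [e5]; linarith
  -- window bookkeeping: whole-space integrals against `Φ = φ ω²` are slab integrals
  have w0 : ∫ x, Φ x * fderiv ℝ P x eZ = ∫ x in zSlab L 0, φ x * fderiv ℝ P x eZ := by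
    obtain ⟨c0, -, -, -⟩ := window_bookkeeping hL (Q := fun x => φ x * fderiv ℝ P x eZ)
      (hφc.mul (hDPc.clm_apply continuous_const)) (fun x => by simp only [hφper x, hqper x]) (ρ := ρ)
      (fun x hx => by rw [hφ0 x hx, zero_mul])
    rw [← c0]; refine integral_congr_ae (Eventually.of_forall fun x => ?_)
    simp only [hΦ]; ring
  have w1 : ∀ i, ∫ x, fderiv ℝ Φ x (b i) * ⟪fderiv ℝ U x (b i), eZ⟫ =
      ∫ x in zSlab L 0, fderiv ℝ φ x (b i) * ⟪fderiv ℝ U x (b i), eZ⟫ := by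
    intro i
    obtain ⟨cA, -, iA, -⟩ := window_bookkeeping hL
      (Q := fun x => fderiv ℝ φ x (b i) * ⟪fderiv ℝ U x (b i), eZ⟫)
      ((hDφc.clm_apply continuous_const).mul ((hDUc.clm_apply continuous_const).inner continuous_const))
      (fun x => by simp only [hDφper x, hDUper x]) (ρ := ρ)
      (fun x hx => by rw [hφD0 x hx]; simp)
    obtain ⟨-, cB, -, iB⟩ := window_bookkeeping hL
      (Q := fun x => φ x * (b i) 2 * ⟪fderiv ℝ U x (b i), eZ⟫)
      ((hφc.mul continuous_const).mul ((hDUc.clm_apply continuous_const).inner continuous_const))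
      (fun x => by simp only [hφper x, hDUper x]) (ρ := ρ)
      (fun x hx => by rw [hφ0 x hx]; simp)
    rw [← cA, ← add_zero (∫ x, fderiv ℝ φ x (b i) * _ * _), ← cB, ← integral_add iA iB]
    refine integral_congr_ae (Eventually.of_forall fun x => ?_)
    simp only [hDΦ]; ring
  have w2 : ∫ x, fderiv ℝ Φ x (U x) * ⟪U x, eZ⟫ =
      ∫ x in zSlab L 0, fderiv ℝ φ x (U x) * ⟪U x, eZ⟫ := by
    obtain ⟨cA, -, iA, -⟩ := window_bookkeeping hL
      (Q := fun x => fderiv ℝ φ x (U x) * ⟪U x, eZ⟫)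
      ((hDφc.clm_apply hUc).mul (hUc.inner continuous_const))
      (fun x => by simp only [hDφper x, hUper x]) (ρ := ρ)
      (fun x hx => by rw [hφD0 x hx]; simp)
    obtain ⟨-, cB, -, iB⟩ := window_bookkeeping hL
      (Q := fun x => φ x * (U x) 2 * ⟪U x, eZ⟫)
      ((hφc.mul ((continuous_apply 2).comp ((PiLp.continuous_ofLp 2 _).comp hUc))).mul
        (hUc.inner continuous_const))
      (fun x => by simp only [hφper x, hUper x]) (ρ := ρ)
      (fun x hx => by rw [hφ0 x hx]; simp)
    rw [← cA, ← add_zero (∫ x, fderiv ℝ φ x (U x) * _ * _), ← cB, ← integral_add iA iB]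
    refine integral_congr_ae (Eventually.of_forall fun x => ?_)
    simp only [hDΦ]; ring
  rw [w0, w2] at whole
  simp_rw [w1] at whole
  exact whole

end Summit.NavierStokesRegularity.NavierStokesRegularity.Theorems.ScenarioCensus.HelicalSlab

end
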